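import Literature.NumberTheory.EllipticCurves.AtkinLehnerMinusSymbolSymmetryProofs
import Literature.NumberTheory.EllipticCurves.PAdicMeasureFunctionalEquationProofs
import Literature.NumberTheory.EllipticCurves.PAdicMeasureTransformBranches
import Literature.NumberTheory.EllipticCurves.PAdicLFunctionMinusDenominatorsProofs
import Literature.NumberTheory.EllipticCurves.ModularSymbolsManinDrinfeldGeneralProofs
import Literature.NumberTheory.EllipticCurves.AtkinLehnerInvolutionsNewformProofs
import HarnessLib

/-!
# The functional equation of the ODD branches `L⁻_p(f, a_p, ω^i, T)` of the `p`-adic `L`-function at a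
# prime `p ‖ N` of MULTIPLICATIVE reduction (Mazur–Tate–Teitelbaum 1986, §I.17), for the self-dual
# tame characters `ω^{2i} = 1`

Topic `NumberTheory/EllipticCurves`. Theorems only (no definition, no named fact; D-0014/D-0026).
Companion of `PAdicLFunctionMultiplicativeFunctionalEquationProofs` (the EVEN branch `ω⁰` at `p ‖ N`:
`IsMultPAdicLFunctionOf.subst_eq_of_atkinLehner`) for the objects of `PAdicLFunctionMinusMult`: the
one-term minus measure `μ⁻_{f,α}(a + pⁿℤ_p) = α⁻ⁿ[a/pⁿ]⁻_f` (Mazur–Tate–Teitelbaum §I.10 (10.1) with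
`ε(p) = 0`) and its `ω^i`-branches `padicLFunctionMinusBranchMult f α i = ∫ ω^i(x)(1+T)^{ℓ(x)} dμ⁻`.

Mazur–Tate–Teitelbaum 1986, §I.17: the change of variables `x ↦ −1/(Mx)` (`M = N/p` the prime-to-`p`
part of the level; `ω(−1/(Mx))^i = ω(−M)^{−i} ω(x)^{−i}`, `⟨−1/(Mx)⟩ = ⟨M⟩⁻¹⟨x⟩⁻¹`) and the
Atkin–Lehner symmetry of the measure (`μ⁻(u) = σ μ⁻(u')` for `M u u' ≡ −1`, `w_M f = −σ f`; tree
theorem `msdMinusMeasureMult_eq_mul_of_atkinLehner`) turn the `ω^i`-branch at `T` into the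
`ω^{−i}`-branch at `T^ι = (1+T)⁻¹ − 1` times `σ ω(−M)^i ⟨M⟩`-power. For the SELF-DUAL tame characters
(`τ ∣ 2i`, `τ = #μ(ℤ_p)_{tors}`: at `p = 2` EVERY `i`, since `ω = χ₋₄` is quadratic; at odd `p` the
Legendre branch `i = (p−1)/2`) this is a functional equation of ONE branch:

  **`L⁻_p(f, a_p, ω^i, ι(T)) = w · (1 + T)^c · L⁻_p(f, a_p, ω^i, T)`**, `w = σ · ω(−M)^i = ±1`,
  `⟨M⟩ = γ^c`.

The proof is the tree's measure-generic engine `subst_eq_of_measure_symmetry`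
(`PAdicMeasureFunctionalEquationProofs`, modulus `K = M`) applied to the `ω^i`-twisted family
`branchTwist i μ⁻` of `PAdicMeasureTransformBranches` (whose plain Riemann sums ARE the weighted
Riemann sums of the branch, `weightedRiemannSum_eq`), the twisted family being `σ ω(−M)^i`-symmetric
(`branchTwist_eq_mul_of_symmetry`: the Teichmüller weight satisfies `ω(u)^i = ω(−M)^i ω(u')^i` when
`M u u' ≡ −1` and `ω^{2i} = 1`, `teichWeight_eq_mul_of_mul_mul_eq_neg_one`). Inputs, all tree
theorems: the distribution law of `μ⁻` (`sum_fiber_msdMinusMeasureMult_succ_eq_of_coeffField`, the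
`U_p`-relation), its boundedness (Manin–Drinfeld, `exists_forall_norm_ratMinusSymbol_le_of_maninDrinfeld`
with `exists_nsmul_modularSymbol_mem_periodLattice_holds`), convergence of the branch Riemann sums
(`tendsto_padicLMinusBranchMultRiemannSum`), the Atkin–Lehner sign of a newform at `M ∥ N`
(`IsNewform0.exists_atkinLehnerInvolution_eq_smul`, Knapp Thm. 9.27(b)) and the exponent of `⟨M⟩`
(`exists_teichmuller_exponent_natCast`).

* `teichReduce_mul`, `teichRep_mul`, `teichRep_neg_one`, `coe_teichRep_pow_torsionOrder` — the
  Teichmüller representative `(ℤ/p^{e₀})ˣ → μ_τ` is multiplicative, `ω(−1) = −1`, `ω(a)^τ = 1`;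
* `teichWeight_eq_mul_of_mul_mul_eq_neg_one` — `ω(a)^i = ω(−K)^i ω(b)^i` for `K a b = −1`, `τ ∣ 2i`;
  `teichWeight_sq_eq_one`, `exists_int_cast_eq_teichWeight` (`ω(a)^i = ±1 ∈ ℤ` for `τ ∣ 2i`);
* `branchTwist_eq_mul_of_symmetry` — the `ω^i`-twist of a `σ`-symmetric distribution (modulus `K`) is
  `σ ω(−K)^i`-symmetric;
* `exists_norm_msdMinusMeasureMult_le` — `μ⁻_{f,α}` at `p ∣ N` is bounded for `‖α‖ = 1` (Manin–Drinfeld);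
* `subst_padicLFunctionMinusBranchMult_eq_of_atkinLehner` — **the functional equation** for a rational
  newform `f` of level `N = pM`, `p ∤ M`, `a_p(f) = ±1`, `w_M f = −σ f`, `⟨M⟩ = γ^c`, `τ ∣ 2i`;
* `exists_subst_padicLFunctionMinusBranchMult_eq` — the same with the sign `w = ±1 ∈ ℤ` and the
  exponent `c ∈ ℤ_p` PRODUCED (only hypotheses: rational newform, `N = pM`, `p ∤ M`, `a_p = ±1`, `τ ∣ 2i`).

Consumed at `p = 2`, `i = 1` (the `χ₋₄`-branch of a curve with multiplicative reduction at `2`) by the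
`bsd-2adic` cell's additive `(−1)`-twist block (T20 (d): `(ι L̃) = (L̃)` for an integral multiple `L̃`
of `L⁻_2(f, 1, ω, T)`), see `Summits/BirchSwinnertonDyer/.../ByReductionTypeAtTwoAdditiveOddBranchFunctionalEquation`.

## References

* B. Mazur, J. Tate, J. Teitelbaum, *On `p`-adic analogues of the conjectures of Birch and
  Swinnerton-Dyer*, Invent. Math. 84 (1986), 1–48, §I.10 ((10.1), `ε(p) = 0`), §I.13 (branches),
  §I.17 (functional equation). [MazurTateTeitelbaum1986Invent]
* R. Greenberg, *Iwasawa theory for elliptic curves*, LNM 1716 (1999), §1, pp. 67–68 (`⟨·⟩ = γ^c`).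
  [GreenbergLNM1716]
* A. W. Knapp, *Elliptic curves* (1993), Thm. 9.27(b). [Knapp1993]
* L. C. Washington, *Introduction to cyclotomic fields*, GTM 83, §5.1 (`ω`). [Washington1997]
-/

noncomputable section

open scoped MatrixGroups ModularForm

open Filter Topology PowerSeries CongruenceSubgroup Literature.NumberTheory.EllipticCurves.ModularForms

namespace Literature.NumberTheory.EllipticCurves

/-! ### The Teichmüller representative is multiplicative; `ω(−1) = −1`; `ω^τ = 1` -/

section Teich

variable (p : ℕ) [Fact p.Prime]

/-- `teichReduce` (reduction `μ_τ(ℤ_p) → (ℤ/p^{e₀})ˣ`) is multiplicative (it is the restriction of the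
unit map of a ring homomorphism). [cite: Washington1997, §5.1] -/
theorem teichReduce_mul (ζ ζ' : rootsOfUnity (torsionOrder p) ℤ_[p]) :
    teichReduce p (ζ * ζ') = teichReduce p ζ * teichReduce p ζ' := by
  unfold teichReduce
  rw [Subgroup.coe_mul, map_mul]

/-- **`ω(ab) = ω(a) ω(b)`**: the Teichmüller representative `(ℤ/p^{e₀})ˣ → μ_τ(ℤ_p)` is multiplicative
(it is the inverse of the multiplicative bijection `teichReduce`). [cite: Washington1997, §5.1] -/
theorem teichRep_mul (a b : (ZMod (p ^ cyclotomicExponent p))ˣ) :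
    teichRep p (a * b) = teichRep p a * teichRep p b := by
  apply (teichReduce_bijective p).1
  rw [teichReduce_mul, teichReduce_teichRep, teichReduce_teichRep, teichReduce_teichRep]

/-- `teichReduce (−1) = −1`. [cite: Washington1997, §5.1] -/
theorem teichReduce_neg_one :
    teichReduce p ⟨-1, neg_one_mem_rootsOfUnity_torsionOrder p⟩ = -1 := by
  ext
  rw [val_teichReduce, Units.val_neg, Units.val_one]
  change PadicInt.toZModPow (cyclotomicExponent p) (((-1 : ℤ_[p]ˣ) : ℤ_[p])) = -1
  rw [Units.val_neg, Units.val_one, map_neg, map_one]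

/-- **`ω(−1) = −1`**: `−1` is its own Teichmüller representative (`−1 ∈ μ_τ`,
`neg_one_mem_rootsOfUnity_torsionOrder`). [cite: Washington1997, §5.1] -/
theorem teichRep_neg_one :
    teichRep p (-1) = ⟨-1, neg_one_mem_rootsOfUnity_torsionOrder p⟩ := by
  rw [← teichReduce_neg_one p, teichRep_teichReduce]

/-- `ω(−1) = −1` on the underlying `p`-adic integers. [cite: Washington1997, §5.1] -/
theorem coe_teichRep_neg_one :
    (((teichRep p (-1) : rootsOfUnity (torsionOrder p) ℤ_[p]) : ℤ_[p]ˣ) : ℤ_[p]) = -1 := by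
  rw [teichRep_neg_one]
  rfl

/-- `ω(a)^τ = 1` (`ω(a) ∈ μ_τ`). [cite: Washington1997, §5.1] -/
theorem coe_teichRep_pow_torsionOrder (a : (ZMod (p ^ cyclotomicExponent p))ˣ) :
    (((teichRep p a : rootsOfUnity (torsionOrder p) ℤ_[p]) : ℤ_[p]ˣ) : ℤ_[p]) ^ torsionOrder p = 1 := by
  have h := (teichRep p a).2
  rw [mem_rootsOfUnity] at h
  have h' := congrArg (fun u : ℤ_[p]ˣ ↦ (u : ℤ_[p])) h
  simpa only [Units.val_pow_eq_pow_val, Units.val_one] using h'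

/-- `ω(ab)^i = ω(a)^i ω(b)^i` for the `ℚ_p`-valued weights `teichWeight p i` on unit classes.
[cite: MazurTateTeitelbaum1986Invent, §I.13] -/
theorem teichWeight_mul_units (i : ℕ) (a b : (ZMod (p ^ cyclotomicExponent p))ˣ) :
    teichWeight p i ((a * b : (ZMod (p ^ cyclotomicExponent p))ˣ) : ZMod (p ^ cyclotomicExponent p)) =
      teichWeight p i (a : ZMod (p ^ cyclotomicExponent p)) *
        teichWeight p i (b : ZMod (p ^ cyclotomicExponent p)) := by
  rw [teichWeight_units, teichWeight_units, teichWeight_units, teichRep_mul, Subgroup.coe_mul,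
    Units.val_mul, PadicInt.coe_mul, mul_pow]

/-- `ω(a)^τ = 1` for the `ℚ_p`-valued weight with exponent `τ`: `teichWeight p τ a = 1` on units.
[cite: MazurTateTeitelbaum1986Invent, §I.13] -/
theorem teichWeight_torsionOrder_units (a : (ZMod (p ^ cyclotomicExponent p))ˣ) :
    teichWeight p (torsionOrder p) (a : ZMod (p ^ cyclotomicExponent p)) = 1 := by
  rw [teichWeight_units, ← PadicInt.coe_pow, coe_teichRep_pow_torsionOrder, PadicInt.coe_one]

/-- `teichWeight p (i + j) a = teichWeight p i a * teichWeight p j a` on units. [cite: MazurTateTeitelbaum1986Invent, §I.13] -/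
theorem teichWeight_add_units (i j : ℕ) (a : (ZMod (p ^ cyclotomicExponent p))ˣ) :
    teichWeight p (i + j) (a : ZMod (p ^ cyclotomicExponent p)) =
      teichWeight p i (a : ZMod (p ^ cyclotomicExponent p)) *
        teichWeight p j (a : ZMod (p ^ cyclotomicExponent p)) := by
  rw [teichWeight_units, teichWeight_units, teichWeight_units, pow_add]

/-- `teichWeight p (i * j) a = (teichWeight p i a)^j` on units. [cite: MazurTateTeitelbaum1986Invent, §I.13] -/
theorem teichWeight_mul_eq_pow_units (i j : ℕ) (a : (ZMod (p ^ cyclotomicExponent p))ˣ) :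
    teichWeight p (i * j) (a : ZMod (p ^ cyclotomicExponent p)) =
      teichWeight p i (a : ZMod (p ^ cyclotomicExponent p)) ^ j := by
  rw [teichWeight_units, teichWeight_units, pow_mul]

/-- **`ω(a)^{2i} = 1` for a self-dual exponent `τ ∣ 2i`**: `(teichWeight p i a)² = 1` on units.
[cite: MazurTateTeitelbaum1986Invent, §I.13] -/
theorem teichWeight_sq_eq_one {i : ℕ} (hi : torsionOrder p ∣ 2 * i)
    (a : (ZMod (p ^ cyclotomicExponent p))ˣ) :
    teichWeight p i (a : ZMod (p ^ cyclotomicExponent p)) ^ 2 = 1 := by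
  obtain ⟨j, hj⟩ := hi
  rw [← teichWeight_mul_eq_pow_units, mul_comm i 2, hj, teichWeight_mul_eq_pow_units,
    teichWeight_torsionOrder_units, one_pow]

/-- `ω(−1)^i = (−1)^i`. [cite: MazurTateTeitelbaum1986Invent, §I.13] -/
theorem teichWeight_neg_one (i : ℕ) :
    teichWeight p i (((-1 : (ZMod (p ^ cyclotomicExponent p))ˣ) : ZMod (p ^ cyclotomicExponent p))) =
      (-1) ^ i := by
  rw [teichWeight_units, coe_teichRep_neg_one, PadicInt.coe_neg, PadicInt.coe_one]

/-- **The Teichmüller weight along the involution `x ↦ −1/(Kx)`**: if `K a b = −1` in `ℤ/p^{e₀}` and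
`τ ∣ 2i` (the tame character `ω^i` is self-dual, `ω^{−i} = ω^i`), then
`ω(a)^i = ω(−K)^i · ω(b)^i` (`ω(a) = ω(−1) ω(K)⁻¹ ω(b)⁻¹` and `ω(·)^{−i} = ω(·)^i`). At `p = 2`
(`τ = 2`, `ω = χ₋₄`) this holds for every `i`. [cite: MazurTateTeitelbaum1986Invent, §I.13 and §I.17] -/
theorem teichWeight_eq_mul_of_mul_mul_eq_neg_one {i : ℕ} (hi : torsionOrder p ∣ 2 * i)
    {K a b : ZMod (p ^ cyclotomicExponent p)} (h : K * a * b = -1) :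
    teichWeight p i a = teichWeight p i (-K) * teichWeight p i b := by
  -- all three are units
  have hKab : K * a * b * (K * a * b) = 1 := by rw [h]; ring
  have ha : IsUnit a := IsUnit.of_mul_eq_one (K * b * (K * a * b)) (by linear_combination hKab)
  have hb : IsUnit b := IsUnit.of_mul_eq_one (K * a * (K * a * b)) (by linear_combination hKab)
  have hK : IsUnit K := IsUnit.of_mul_eq_one (a * b * (K * a * b)) (by linear_combination hKab)
  obtain ⟨ua, rfl⟩ := ha
  obtain ⟨ub, rfl⟩ := hb
  obtain ⟨uK, rfl⟩ := hK
  -- the unit relation `uK ua ub = -1`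
  have hu : uK * ua * ub = -1 := by
    ext; push_cast; exact h
  have hneg : (-(uK : ZMod (p ^ cyclotomicExponent p))) =
      ((-uK : (ZMod (p ^ cyclotomicExponent p))ˣ) : ZMod (p ^ cyclotomicExponent p)) :=
    (Units.val_neg uK).symm
  rw [hneg]
  -- `ω(uK)^i ω(ua)^i ω(ub)^i = (-1)^i`
  have hprod : teichWeight p i (uK : ZMod _) * teichWeight p i (ua : ZMod _) *
      teichWeight p i (ub : ZMod _) = (-1) ^ i := by
    rw [← teichWeight_mul_units, ← teichWeight_mul_units, hu, teichWeight_neg_one]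
  have hK2 := teichWeight_sq_eq_one p hi uK
  have hb2 := teichWeight_sq_eq_one p hi ub
  have hnegK : teichWeight p i ((-uK : (ZMod (p ^ cyclotomicExponent p))ˣ) : ZMod _) =
      (-1) ^ i * teichWeight p i (uK : ZMod _) := by
    rw [show (-uK : (ZMod (p ^ cyclotomicExponent p))ˣ) = -1 * uK by rw [neg_one_mul],
      teichWeight_mul_units, teichWeight_neg_one]
  rw [hnegK]
  -- `ω(ua)^i = (-1)^i ω(uK)^i ω(ub)^i`, from `hprod` times `ω(uK)^i ω(ub)^i` and the squares
  have hm1 : ((-1 : ℚ_[p]) ^ i) ^ 2 = 1 := by rw [← pow_mul, mul_comm, pow_mul, neg_one_sq, one_pow]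
  linear_combination (teichWeight p i (uK : ZMod _) * teichWeight p i (ub : ZMod _)) * hprod -
    teichWeight p i (ua : ZMod _) * teichWeight p i (ub : ZMod _) ^ 2 * hK2 -
    teichWeight p i (ua : ZMod _) * hb2 +
    (-1) ^ i * teichWeight p i (uK : ZMod _) * teichWeight p i (ub : ZMod _) * (hm1 - hm1)

/-- **`ω(a)^i = ±1 ∈ ℤ` for a self-dual exponent** (`τ ∣ 2i`, `a` a unit class): there is `w ∈ ℤ`,
`w² = 1`, with `(w : ℚ_p) = teichWeight p i a`. [cite: MazurTateTeitelbaum1986Invent, §I.13] -/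
theorem exists_int_cast_eq_teichWeight {i : ℕ} (hi : torsionOrder p ∣ 2 * i)
    {a : ZMod (p ^ cyclotomicExponent p)} (ha : IsUnit a) :
    ∃ w : ℤ, w ^ 2 = 1 ∧ (w : ℚ_[p]) = teichWeight p i a := by
  obtain ⟨ua, rfl⟩ := ha
  have h2 := teichWeight_sq_eq_one p hi ua
  rw [sq] at h2
  rcases mul_self_eq_one_iff.mp h2 with h | h
  · exact ⟨1, by norm_num, by rw [h]; push_cast; rfl⟩
  · exact ⟨-1, by norm_num, by rw [h]; push_cast; rfl⟩

end Teich

/-! ### The `ω^i`-twist of a symmetric distribution is symmetric -/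

section Twist

variable {p : ℕ} [Fact p.Prime] {μ : (n : ℕ) → ZMod (p ^ n) → ℚ_[p]}

/-- **The `ω^i`-twisted family of a `σ`-symmetric distribution is `σ ω(−K)^i`-symmetric** (self-dual
`i`, `τ ∣ 2i`): if `μ` is a distribution with `μ(u + p^{n+e₀}ℤ_p) = σ μ(u' + p^{n+e₀}ℤ_p)` whenever
`K u u' = −1 (mod p^{n+e₀})`, then the family `ω^i μ = branchTwist i μ` satisfies
`(ω^i μ)(u) = σ ω(−K)^i · (ω^i μ)(u')` for the same pairs — at levels `≥ e₀`,
`(ω^i μ)(u) = μ(u) ω(u)^i` (`branchTwist_apply_of_distribution`) and `ω(u)^i = ω(−K)^i ω(u')^i`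
(`teichWeight_eq_mul_of_mul_mul_eq_neg_one`). This is the change of variables `x ↦ −1/(Kx)` in
`∫ ω^i (·) dμ` (Mazur–Tate–Teitelbaum 1986, §I.17). [cite: MazurTateTeitelbaum1986Invent, §I.13 and §I.17] -/
theorem branchTwist_eq_mul_of_symmetry
    (hdist : ∀ (n : ℕ) (a : ZMod (p ^ n)),
      ∑ b ∈ Finset.univ.filter (fun b : ZMod (p ^ (n + 1)) ↦
        ZMod.castHom (pow_dvd_pow p n.le_succ) (ZMod (p ^ n)) b = a), μ (n + 1) b = μ n a)
    {K : ℕ} {σ : ℚ_[p]} (n : ℕ)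
    (hsym : ∀ u u' : ZMod (p ^ (n + cyclotomicExponent p)),
      (K : ZMod (p ^ (n + cyclotomicExponent p))) * u * u' = -1 →
        μ (n + cyclotomicExponent p) u = σ * μ (n + cyclotomicExponent p) u')
    {i : ℕ} (hi : torsionOrder p ∣ 2 * i) (u u' : ZMod (p ^ (n + cyclotomicExponent p)))
    (h : (K : ZMod (p ^ (n + cyclotomicExponent p))) * u * u' = -1) :
    branchTwist i μ (n + cyclotomicExponent p) u =
      (σ * teichWeight p i (-(K : ZMod (p ^ cyclotomicExponent p)))) *
        branchTwist i μ (n + cyclotomicExponent p) u' := by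
  have hle : cyclotomicExponent p ≤ n + cyclotomicExponent p := Nat.le_add_left _ _
  rw [branchTwist_apply_of_distribution hdist i hle, branchTwist_apply_of_distribution hdist i hle,
    hsym u u' h]
  have h' : (K : ZMod (p ^ cyclotomicExponent p)) *
      ZMod.castHom (pow_dvd_pow p hle) (ZMod (p ^ cyclotomicExponent p)) u *
        ZMod.castHom (pow_dvd_pow p hle) (ZMod (p ^ cyclotomicExponent p)) u' = -1 := by
    have := congrArg (ZMod.castHom (pow_dvd_pow p hle) (ZMod (p ^ cyclotomicExponent p))) h
    simpa only [map_mul, map_natCast, map_neg, map_one] using this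
  rw [teichWeight_eq_mul_of_mul_mul_eq_neg_one p hi h']
  ring

end Twist

/-! ### The functional equation of the odd branches at `p ‖ N` -/

section Main

variable {N : ℕ} [NeZero N] {f : CuspForm (Gamma0 N) 2} {p : ℕ} [Fact p.Prime]

/-- **`μ⁻_{f,α}` at `p ∣ N` is bounded for `‖α‖_p = 1`** (Manin–Drinfeld alone, for every
`f ∈ S₂(Γ₀(N))`): `‖α⁻ⁿ[a/pⁿ]⁻_f‖ ≤ ‖D‖_p⁻¹` with `D` the common denominator of the minus symbols
(`exists_forall_norm_ratMinusSymbol_le_of_maninDrinfeld`, `exists_nsmul_modularSymbol_mem_periodLattice_holds`).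
[cite: MazurTateTeitelbaum1986Invent, §I.8 and §I.11] -/
theorem exists_norm_msdMinusMeasureMult_le {α : ℚ_[p]} (hα : ‖α‖ = 1) :
    ∃ C : ℝ, ∀ (n : ℕ) (a : ZMod (p ^ n)), ‖msdMinusMeasureMult f α n a‖ ≤ C := by
  obtain ⟨C, -, hC⟩ := exists_forall_norm_ratMinusSymbol_le_of_maninDrinfeld (p := p)
    (exists_nsmul_modularSymbol_mem_periodLattice_holds f)
  refine ⟨C, fun n a ↦ ?_⟩
  rw [msdMinusMeasureMult, norm_mul, norm_pow, norm_inv, hα, inv_one, one_pow, one_mul]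
  exact hC _

/-- **Functional equation of the self-dual odd branches at a prime `p ‖ N`** (Mazur–Tate–Teitelbaum
1986, §I.17). Let `f ∈ S₂(Γ₀(N))` be a newform with rational coefficients, `N = pM` with `p ∤ M`,
`a_p(f) = a_p ∈ {±1}` (multiplicative reduction; `α = a_p` is the allowable root, `ε(p) = 0`),
`w_M f = −σ f` (`σ = ±1`), `⟨M⟩ = γ^c` (`hc`, `exists_teichmuller_exponent_natCast`), and let `i` be
a self-dual exponent, `τ ∣ 2i`. Then for every `ι ∈ ℚ_p⟦T⟧` with `(1 + T)(1 + ι) = 1`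
(`ι = (1+T)⁻¹ − 1`):
`L⁻_p(f, a_p, ω^i, ι(T)) = σ ω(−M)^i · (1 + T)^c · L⁻_p(f, a_p, ω^i, T)` with
`(1+T)^c = PowerSeries.binomialSeries ℚ_[p] c` and `ω(−M)^i = teichWeight p i (−M) = ±1`. Proof: the
measure-generic engine `subst_eq_of_measure_symmetry` (modulus `K = M`) for the twisted family
`ω^i μ⁻` (`weightedRiemannSum_eq`, `branchTwist_eq_mul_of_symmetry`, `norm_branchTwist_le`,
`tendsto_padicLMinusBranchMultRiemannSum`), the symmetry being `msdMinusMeasureMult_eq_mul_of_atkinLehner`.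
[cite: MazurTateTeitelbaum1986Invent, §I.17] [cite: GreenbergLNM1716, §1 (pp. 67–68)] -/
theorem subst_padicLFunctionMinusBranchMult_eq_of_atkinLehner {M : ℕ} [NeZero M]
    (hf : IsNewform0 f) (hQ : coeffField f = ⊥) (hNM : N = p * M) (hpM : ¬ p ∣ M)
    {ap : ℤ} (hap : cuspCoeff f p = ap) (hap1 : ap ^ 2 = 1)
    {σ : ℤ} (hσ : σ ^ 2 = 1) (hW : atkinLehnerInvolution N 2 M f = (-(σ : ℂ)) • f)
    {ηM : rootsOfUnity (torsionOrder p) ℤ_[p]} {c : ℤ_[p]}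
    (hc : ∀ n : ℕ, PadicInt.toZModPow (n + cyclotomicExponent p) ((ηM : ℤ_[p]ˣ) : ℤ_[p]) *
        (cyclotomicGenerator p : ZMod (p ^ (n + cyclotomicExponent p))) ^ (PadicInt.toZModPow n c).val =
          (M : ZMod (p ^ (n + cyclotomicExponent p))))
    {i : ℕ} (hi : torsionOrder p ∣ 2 * i)
    {ι : ℚ_[p]⟦X⟧} (hι : (1 + X : ℚ_[p]⟦X⟧) * (ι + 1) = 1) :
    PowerSeries.subst ι (padicLFunctionMinusBranchMult f (ap : ℚ_[p]) i) =
      C ((σ : ℚ_[p]) * teichWeight p i (-(M : ZMod (p ^ cyclotomicExponent p)))) *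
        PowerSeries.binomialSeries ℚ_[p] c * padicLFunctionMinusBranchMult f (ap : ℚ_[p]) i := by
  -- the inputs: distribution law, bound, convergence
  have hpN : p ∣ N := ⟨M, hNM⟩
  have hap' : ap = 1 ∨ ap = -1 := mul_self_eq_one_iff.mp (by rw [← sq]; exact hap1)
  have hapn : ‖((ap : ℤ) : ℚ_[p])‖ = 1 := by
    rcases hap' with rfl | rfl
    · simp
    · simp
  have hap0 : ((ap : ℤ) : ℚ_[p]) ≠ 0 := fun h0 ↦ by rw [h0, norm_zero] at hapn; exact zero_ne_one hapn
  have hdist := sum_fiber_msdMinusMeasureMult_succ_eq_of_coeffField (p := p) hf hQ hpN hap hap0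
  obtain ⟨C₀, hC₀⟩ := exists_norm_msdMinusMeasureMult_le (f := f) hapn
  -- the twisted family and its Riemann sums
  have hRS : ∀ k n : ℕ, padicLMinusBranchMultRiemannSum f (ap : ℚ_[p]) i k n =
      ∑ᶠ ζ : rootsOfUnity (torsionOrder p) ℤ_[p], ∑ s : ZMod (p ^ n),
        branchTwist i (msdMinusMeasureMult f (ap : ℚ_[p])) (n + cyclotomicExponent p)
            (PadicInt.toZModPow (n + cyclotomicExponent p) ((ζ : ℤ_[p]ˣ) : ℤ_[p]) *
              (cyclotomicGenerator p : ZMod (p ^ (n + cyclotomicExponent p))) ^ s.val) *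
          ((s.val.choose k : ℕ) : ℚ_[p]) := fun k n ↦
    weightedRiemannSum_eq (RS := padicLMinusBranchMultRiemannSum f (ap : ℚ_[p]) i)
      (fun _ _ ↦ rfl) hdist k n
  have hbdd : ∃ C : ℝ, ∀ (n : ℕ) (a : ZMod (p ^ n)),
      ‖branchTwist i (msdMinusMeasureMult f (ap : ℚ_[p])) n a‖ ≤ C :=
    ⟨C₀, fun n a ↦ norm_branchTwist_le hC₀ i n a⟩
  have htend : ∀ k : ℕ, Tendsto (padicLMinusBranchMultRiemannSum f (ap : ℚ_[p]) i k) atTop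
      (𝓝 (coeff k (padicLFunctionMinusBranchMult f (ap : ℚ_[p]) i))) := fun k ↦ by
    rw [coeff_padicLFunctionMinusBranchMult]
    exact tendsto_padicLMinusBranchMultRiemannSum f (ap : ℚ_[p]) hdist hC₀ i k
  -- the symmetry of the twisted family under `x ↦ -1/(Mx)`
  have hsym : ∀ (n : ℕ) (u u' : ZMod (p ^ (n + cyclotomicExponent p))),
      (M : ZMod (p ^ (n + cyclotomicExponent p))) * u * u' = -1 →
        branchTwist i (msdMinusMeasureMult f (ap : ℚ_[p])) (n + cyclotomicExponent p) u =
          ((σ : ℚ_[p]) * teichWeight p i (-(M : ZMod (p ^ cyclotomicExponent p)))) *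
            branchTwist i (msdMinusMeasureMult f (ap : ℚ_[p])) (n + cyclotomicExponent p) u' := by
    intro n u u' h
    have hL : 1 ≤ n + cyclotomicExponent p :=
      le_add_left (Nat.pos_of_ne_zero (cyclotomicExponent_ne_zero p))
    exact branchTwist_eq_mul_of_symmetry hdist n
      (fun v v' hv ↦ msdMinusMeasureMult_eq_mul_of_atkinLehner hNM hpM hσ hW (ap : ℚ_[p]) hL hv)
      hi u u' h
  exact subst_eq_of_measure_symmetry hRS hbdd htend hsym hc hι

/-- **The functional equation with the sign and the exponent PRODUCED**: for a rational newform `f`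
of level `N = pM`, `p ∤ M`, with `a_p(f) = ±1`, and a self-dual exponent `τ ∣ 2i`, there are
`w ∈ ℤ` with `w² = 1` and `c ∈ ℤ_p` such that
`L⁻_p(f, a_p, ω^i, ι(T)) = w · (1 + T)^c · L⁻_p(f, a_p, ω^i, T)` for every `ι` with
`(1 + T)(1 + ι) = 1`. Here `w = σ · ω(−M)^i` (`w_M f = −σ f`, Knapp Thm. 9.27(b):
`IsNewform0.exists_atkinLehnerInvolution_eq_smul`; `ω(−M)^i = ±1`, `exists_int_cast_eq_teichWeight`)
and `⟨M⟩ = γ^c` (`exists_teichmuller_exponent_natCast`). [cite: MazurTateTeitelbaum1986Invent, §I.17]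
[cite: Knapp1993, Thm. 9.27(b)] -/
theorem exists_subst_padicLFunctionMinusBranchMult_eq {M : ℕ}
    (hf : IsNewform0 f) (hQ : coeffField f = ⊥) (hNM : N = p * M) (hpM : ¬ p ∣ M)
    {ap : ℤ} (hap : cuspCoeff f p = ap) (hap1 : ap ^ 2 = 1) {i : ℕ} (hi : torsionOrder p ∣ 2 * i) :
    ∃ w : ℤ, w ^ 2 = 1 ∧ ∃ c : ℤ_[p], ∀ {ι : ℚ_[p]⟦X⟧}, (1 + X : ℚ_[p]⟦X⟧) * (ι + 1) = 1 →
      PowerSeries.subst ι (padicLFunctionMinusBranchMult f (ap : ℚ_[p]) i) =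
        C ((w : ℤ) : ℚ_[p]) * PowerSeries.binomialSeries ℚ_[p] c *
          padicLFunctionMinusBranchMult f (ap : ℚ_[p]) i := by
  have hp : p.Prime := Fact.out
  have hM0 : M ≠ 0 := by rintro rfl; exact hpM (dvd_zero p)
  haveI : NeZero M := ⟨hM0⟩
  -- the Atkin–Lehner sign at `M`
  have hMN : M ∣ N := ⟨p, by rw [hNM, mul_comm]⟩
  have hcop : Nat.Coprime M (N / M) := by
    rw [hNM, mul_comm, Nat.mul_div_cancel_left p (Nat.pos_of_ne_zero hM0)]
    exact ((Nat.Prime.coprime_iff_not_dvd hp).mpr hpM).symm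
  obtain ⟨ε, hε, hWε⟩ := hf.exists_atkinLehnerInvolution_eq_smul (N := N) (k := (2 : ℤ)) hMN hcop
  obtain ⟨σ, hσ, hσε⟩ : ∃ σ : ℤ, σ ^ 2 = 1 ∧ (-(σ : ℂ)) = ε := by
    rcases hε with rfl | rfl
    · exact ⟨-1, by norm_num, by push_cast; ring⟩
    · exact ⟨1, by norm_num, by push_cast; ring⟩
  have hW : atkinLehnerInvolution N 2 M f = (-(σ : ℂ)) • f := by rw [hσε]; exact hWε
  -- the exponent of `⟨M⟩` and the integer `ω(-M)^i = ±1`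
  obtain ⟨ηM, c, hc⟩ := exists_teichmuller_exponent_natCast p hpM
  have hMu : IsUnit (-(M : ZMod (p ^ cyclotomicExponent p))) := by
    refine IsUnit.neg ?_
    rw [ZMod.isUnit_iff_coprime]
    exact (Nat.Coprime.pow_right _ ((hp.coprime_iff_not_dvd).mpr hpM).symm)
  obtain ⟨w₀, hw₀, hw₀'⟩ := exists_int_cast_eq_teichWeight p hi hMu
  refine ⟨σ * w₀, by rw [mul_pow, hσ, hw₀, mul_one], c, fun {ι} hι ↦ ?_⟩
  rw [subst_padicLFunctionMinusBranchMult_eq_of_atkinLehner hf hQ hNM hpM hap hap1 hσ hW hc hi hι,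
    ← hw₀']
  push_cast
  rfl

end Main

end Literature.NumberTheory.EllipticCurves

end
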